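import Literature.NumberTheory.EllipticCurves.BSDSelmerSmithCMTableProofs
import Literature.NumberTheory.EllipticCurves.NoEverywhereGoodReductionRat
import Literature.NumberTheory.EllipticCurves.ModularityVersionApProofs
import HarnessLib

set_option linter.dupNamespace false
set_option autoImplicit false

/-! # Route `MordellShaFreeCut` (rung S2b) — every `j = 0` curve over `ℚ` is BAD at `3`: `3 ∣ Δ_min` and `3 ∣ N`

Cell `bsd-cn100`, prover seat `bsd-cn100-s2b-c3` (g8). Supports, does not close, stmt-BirchSwinnertonDyer-19160 (crux B
`AnalyticRankOneOfRankOneFiniteShaThree`): the binder `3 ∣ N` that x11b3's descent engine (K4″) reads off `ClassX11b W 3` is, on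
the S2b data (`W.j = 0`), a THEOREM — consumed by `MordellShaFreeCutThreeAdicHsiehDescentOfValueReciprocity.lean` (the reduction
of the descent residual `ThreeAdicHsiehDescent` to Tate–Sen + value reciprocity) and available to the (ERL₃) Euler-factor
bookkeeping (`1 − a₃3⁻¹ + [3 ∤ N]3⁻¹` with `3 ∣ N`). ARGUMENT (Silverman X.5.4(ii), VII.5.1(a), VIII.8; Diamond–Shurman §8.3):
`W ≅_ℚ y² = x³ + D`, `D ≠ 0` (`exists_variableChange_eq_j_zero_model`); `Δ(y² = x³ + D) = −432·D²` and a change of variables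
multiplies `Δ` by `u^{−12}`, so `v₃(Δ_W) = 12·v₃(u) + 3 + 2·v₃(D)` is ODD; for a globally minimal `W`, `Δ_W = Δ_min ∈ ℤ`, so
`3 ∣ Δ_min`, hence bad reduction at `3` (`not_hasGoodReductionAtPrime_of_dvd_minimalDiscriminantInt`) and `3 ∣ N_W`
(`dvd_conductorNorm_iff_not_hasGoodReductionAtPrime`). THEOREMS ONLY; nothing about crux B, Sylvester or BSD.
PARTITION: none — RANK axis. -/

namespace Summit.BirchSwinnertonDyer.BirchSwinnertonDyer.Theorems.MordellShaFreeCutJZeroConductorThree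

open WeierstrassCurve Literature.NumberTheory.EllipticCurves

/-- The `3`-adic valuation of `432 = 2⁴·3³` is `3`. [folklore] -/
theorem padicValRat_three_432 : padicValRat 3 (432 : ℚ) = 3 := by
  haveI : Fact (Nat.Prime 3) := ⟨Nat.prime_three⟩
  have h : (432 : ℚ) = (3 : ℚ) ^ 3 * 16 := by norm_num
  have h16 : padicValRat 3 (16 : ℚ) = 0 := by
    rw [show (16 : ℚ) = ((16 : ℕ) : ℚ) by norm_num, padicValRat.of_nat]
    exact_mod_cast padicValNat.eq_zero_of_not_dvd (by norm_num)
  rw [h, padicValRat.mul (by norm_num) (by norm_num), padicValRat.pow (3 : ℚ),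
    show (3 : ℚ) = ((3 : ℕ) : ℚ) by norm_num, padicValRat.self (by norm_num), h16]
  norm_num

/-- **`3 ∣ Δ_min` for every globally minimal elliptic `W/ℚ` with `j(W) = 0`**: `W ≅_ℚ y² = x³ + D`, `D ≠ 0`
(`exists_variableChange_eq_j_zero_model`), `Δ(y² = x³ + D) = −432·D²` has `3`-adic valuation `3 + 2·v₃(D)`, a change of
variables multiplies `Δ` by `u^{∓12}`, so `v₃(Δ_W)` is ODD — while `Δ_W = Δ_min ∈ ℤ` would have valuation `0` if `3 ∤ Δ_min`.
[cite: SilvermanAEC2009, X.5 Prop. 5.4(ii) and VIII.8 (minimal discriminant)] -/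
theorem three_dvd_minimalDiscriminantInt_of_j_eq_zero (W : WeierstrassCurve ℚ) [W.IsElliptic]
    [W.IsGloballyMinimal] (hj : W.j = 0) : (3 : ℤ) ∣ minimalDiscriminantInt W := by
  haveI : Fact (Nat.Prime 3) := ⟨Nat.prime_three⟩
  obtain ⟨C, D, hD, hCW⟩ := exists_variableChange_eq_j_zero_model W hj
  have hΔC : (C • W).Δ = -(432 * D ^ 2) := by
    rw [hCW]; simp only [WeierstrassCurve.Δ, WeierstrassCurve.b₂, WeierstrassCurve.b₄, WeierstrassCurve.b₆,
      WeierstrassCurve.b₈]; ring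
  rw [variableChange_Δ] at hΔC
  have hu0 : ((C.u : ℚˣ) : ℚ) ≠ 0 := C.u.ne_zero
  have hWΔ : W.Δ = ((C.u : ℚˣ) : ℚ) ^ 12 * (-(432 * D ^ 2)) := by
    rw [← hΔC, ← mul_assoc, ← mul_pow, Units.mul_inv, one_pow, one_mul]
  have h432D : (-(432 * D ^ 2) : ℚ) ≠ 0 := neg_ne_zero.2 (mul_ne_zero (by norm_num) (pow_ne_zero 2 hD))
  have hv : padicValRat 3 W.Δ = 12 * padicValRat 3 ((C.u : ℚˣ) : ℚ) + (3 + 2 * padicValRat 3 D) := by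
    rw [hWΔ, padicValRat.mul (pow_ne_zero 12 hu0) h432D, padicValRat.pow ((C.u : ℚˣ) : ℚ), padicValRat.neg,
      padicValRat.mul (by norm_num) (pow_ne_zero 2 hD), padicValRat.pow D, padicValRat_three_432]
    push_cast
    ring
  by_contra h3
  have h0 : padicValRat 3 W.Δ = 0 := by
    rw [← cast_minimalDiscriminantInt W, padicValRat.of_int]
    exact_mod_cast padicValInt.eq_zero_of_not_dvd h3
  omega

/-- **Every elliptic curve `W/ℚ` with `j(W) = 0` has BAD reduction at `3`** (indeed additive: `c₄ = 0`), for a globally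
minimal model: `3 ∣ Δ_min` (`three_dvd_minimalDiscriminantInt_of_j_eq_zero`) and Silverman VII.5.1(a).
[cite: SilvermanAEC2009, VII.5 Prop. 5.1(a) (PDF p. 174)] -/
theorem not_hasGoodReductionAtPrime_three_of_j_eq_zero (W : WeierstrassCurve ℚ) [W.IsElliptic] [W.IsGloballyMinimal]
    (hj : W.j = 0) : ¬ W.HasGoodReductionAtPrime 3 :=
  haveI : Fact (Nat.Prime 3) := ⟨Nat.prime_three⟩
  W.not_hasGoodReductionAtPrime_of_dvd_minimalDiscriminantInt 3 (three_dvd_minimalDiscriminantInt_of_j_eq_zero W hj)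

/-- **`3 ∣ N_W` for every elliptic curve `W/ℚ` with `j(W) = 0`** (globally minimal model; `p ∣ N_E ↔ ¬` good at `p`,
Diamond–Shurman §8.3, tree `dvd_conductorNorm_iff_not_hasGoodReductionAtPrime`).
[cite: DiamondShurman2005, §8.3 (PDF p. 353)] [cite: SilvermanAEC2009, VII.5 Prop. 5.1(a)] -/
theorem three_dvd_conductorNorm_of_j_eq_zero (W : WeierstrassCurve ℚ) [W.IsElliptic] [W.IsGloballyMinimal]
    (hj : W.j = 0) : 3 ∣ W.conductorNorm ℤ :=
  haveI : Fact (Nat.Prime 3) := ⟨Nat.prime_three⟩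
  (W.dvd_conductorNorm_iff_not_hasGoodReductionAtPrime 3).mpr (not_hasGoodReductionAtPrime_three_of_j_eq_zero W hj)

end Summit.BirchSwinnertonDyer.BirchSwinnertonDyer.Theorems.MordellShaFreeCutJZeroConductorThree
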